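import Summits.BirchSwinnertonDyer.Rank1Residual.X11b.RouteR1LogOmega
import Summits.BirchSwinnertonDyer.Rank1Residual.X11b.RouteR1IMCEqCoreFrame
import Summits.BirchSwinnertonDyer.Rank1Residual.X11b.FrameLambdaUnit
import HarnessLib

/-!
# X11b, route R1 at `p ≥ 5` — the ∀-frame halves WITH THE BINDER `Ω_K ≠ 0` (H2∀′, H3∀′): H2∀′ is a
# THEOREM from print on semistable pairs, and H3∀′ is EQUIVALENT to the ∃-core shape of record
# (ideal rigidity across periods + multiplicity one); the gen-21 record, repaired

HONEST FRAMING (cell `b2b-bsdres`, run/shared/lean/b2b/bsd-rank1-residual/, verbatim in every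
file): the goal of the cell is to DELETE the COMBINATION-SHAPED residual classes of the
Birch–Swinnerton-Dyer formula for ALL analytic-rank `≤ 1` elliptic curves over `ℚ` — "full BSD
formula for every rank `≤ 1` curve in class `C`" assembled STRICTLY from published theorems — so
that the rank-`≤ 1` remainder becomes exactly the CONSTRUCTION-SHAPED classes, which are TYPED
(missing-input `Prop`s), NOT attempted. This is not "finishing BSD". Sub-cell
`b2b-bsdres-multr1-p1` (X11b, route R1, gen 26); a RESEARCH ROUTE; no claim beyond the stated
class; X11b stays CONSTRUCTION-SHAPED; nothing here changes a label; TWO `Prop`-valued SHAPES with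
bodies (the gen-21 bodies of `R1.BDPValueOnTree` / `R1.IMCEqOnTree` VERBATIM plus the one binder
`Ω_K ≠ 0`; nothing asserted) and theorems; no named fact; no `sorry`; every result using the OPEN
shape H3∀′ is CONDITIONAL.

## Why this file

Gen 21 typed route R1's two halves at `p ≥ 5` as ∀-frame shapes — H2 `R1.BDPValueOnTree W p`
(Cas18 Thm. 3.2's value at `𝟙`) and H3 `R1.IMCEqOnTree W p` (erratum Thm. 1.1's main-conjecture
equality) demanded at EVERY frame `(Ω_K, Ω_p, L)` with `IsBDPLFunction ι' 𝔭_{ι'} κ γ f Ω_K Ω_p L` —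
but WITHOUT the binder `Ω_K ≠ 0`, and the Literature predicate is satisfied by the degenerate frame
`(0, 1, 0)`; both shapes are therefore REFUTABLE on the population
(`X11b/RouteR1HalvesDegenerateFrame.lean`: `R1.not_imcEqOnTree_of_facts`,
`R1.not_bdpValueOnTree_of_facts`). This file types the CORRECTED shapes and settles their status:

* §1 **`R1.BDPValueAllFramesOnTree W p`** (H2∀′) and **`R1.IMCEqAllFramesOnTree W p`** (H3∀′): the
  gen-21 bodies verbatim with `Ω_K ≠ 0 →` inserted before the interpolation hypothesis. §2: the
  gen-21 shapes imply them (so nothing typed before is lost).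
* §3 **`R1.bdpValueAllFramesOnTree_of_thm32`** — on a SEMISTABLE pair H2∀′ is a THEOREM from the
  registered published fact `h32` (Cas18 Thms. 3.1–3.2) with `hGZK`, `hmod`: the fact's frame at the
  Galois-conjugate reading `τ_* P` carries the value; VALUE RIGIDITY ACROSS PERIODS
  (`R1.bdpValueAtOneOnTreeAt_of_isBDPLFunction`, gen 25) moves it to ANY frame with non-zero
  periods; `(log_{ω_E} τ_* P)² = (log_{ω_E} P)²` in rank one
  (`R1.bdpValueAtOneOnTreeAt_map_iff_of_rank_one`, gen 26) moves it back to `P`; multiplicity one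
  (`IsNewformOf.unique`) identifies the newform with `f_{Dt}`.
* §4 **`R1.imcEqAllFramesOnTree_of_imcEqCoreFrame`** — H3∃⁻ (`R1.IMCEqCoreFrameOnTree`, gen 25: per
  datum ONE frame with interpolation ∧ IMC equality) ⟹ H3∀′, with NO fact and NO semistability:
  IDEAL RIGIDITY ACROSS PERIODS (`R1.imcEqOnTreeAt_forall_of_exists`, gen 25: two frames of the
  same `(ι', 𝔭, κ, γ, f)` with non-zero periods generate the same ideal of `R₀⟦T⟧`) + multiplicity
  one + the Galois re-reading of the datum; **`R1.imcEqCoreFrameOnTree_of_imcEqAllFrames_of_bdpExists`**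
  — conversely on a SEMISTABLE pair, given EXISTENCE of a frame (A206 `hBDP`, or `h32`); hence
  **`R1.imcEqAllFramesOnTree_iff_imcEqCoreFrame`**: on semistable pairs, given A206, the corrected
  ∀-frame half and the ∃-core shape of record are EQUIVALENT — the main-conjecture half of route R1
  is ONE frame-independent statement per datum (the iff that fails for the uncorrected shape).
* (companion `RouteR1HalvesAllFramesRecord.lean`) the gen-21 record REPAIRED:
  `R1.bsdp_of_thm32_of_imcEqAllFrames_record` — `BSD(E,p)` on SEMISTABLE pairs of
  `R1Population ∩ {r_an = 1}` from the same EIGHT PUBLISHED facts (incl. `h32`), the FIVE CITED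
  cohomological facts and H3∀′ — now a NON-vacuous open input, equivalent to H3∃⁻.

CONDITIONAL on H3∀′ (open) where said; deletes nothing; X11b stays CONSTRUCTION-SHAPED; no label
change; wording of record unchanged (the open content on semistable R1 pairs is erratum Thm. 1.1 for
a frame typed with its interpolation property, ⇐ [FW21, Thm. 4.41], PREPRINT).

References: [Castella2018] Thms. 2.3, 3.1, 3.2, §5 (arXiv:1704.06608 pp. 5, 9, 12);
[Castella2018Erratum] Thm. 1.1 (p. 1); [FouquetWan2021] Thm. 4.41.
-/

noncomputable section

open scoped Classical

open WeierstrassCurve NumberField IsDedekindDomain Field PowerSeries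
open Literature.NumberTheory.EllipticCurves Literature.NumberTheory.EllipticCurves.GreenbergSelmer
open Literature.NumberTheory.EllipticCurves.ModularForms
open Literature.NumberTheory.EllipticCurves.Rank1Residual
open Literature.NumberTheory.EllipticCurves.Rank1Residual.Typed
open Literature.NumberTheory.EllipticCurves.Castella2018
open Literature.NumberTheory.GaloisRepresentations
open Literature.NumberTheory.GaloisCohomology
open Summit.BirchSwinnertonDyer.Rank1Residual.X11b.AcSelmer
open Summit.BirchSwinnertonDyer.Rank1Residual.X11b.Halves

namespace Summit.BirchSwinnertonDyer.Rank1Residual.X11b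

/-! ### §1 The corrected ∀-frame shapes (binder `Ω_K ≠ 0`) -/

section Shapes

variable (W : WeierstrassCurve ℚ) [W.IsElliptic] [W.IsGloballyMinimal] (p : ℕ) [Fact p.Prime]

/-- **H2∀′ — Cas18 Thm. 3.2's value at `𝟙` at EVERY GENUINE frame of route R1's data (PUB shape,
typed; the gen-21 body of `R1.BDPValueOnTree` verbatim plus the binder `Ω_K ≠ 0`).** For every datum
of `R1OpenInputOnTreeAt W p` (A′-hypotheses, `r_an = 1`, non-split multiplicative `q ≠ p` with `E[p]`
ramified, erratum field `K` for `q` with [Cas20 §2.5]'s standing hypotheses, a parametrisation datum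
`Dt` at level `N_E` with `p ∤ c`, a Heegner datum `H`, the Heegner point `P` read through `ι_K`, of
infinite order), every newform `f` of `E`, every anticyclotomic `(κ, γ)`, every embedding datum `ι'`
and infinite place `w₀`, and every frame `(Ω_K ≠ 0, Ω_p ∈ R₀ˣ, L)` with
`IsBDPLFunction ι' 𝔭_{ι'} κ γ f Ω_K Ω_p L`: `L(𝟙) = u·((1 − a_p(E) p⁻¹)·log_{ω_E} P)²`, `u ∈ R₀ˣ`, the
logarithm through THE embedding `embAt K p 𝔭_{ι'}`. A predicate on `(W, p)`; nothing asserted; a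
THEOREM on semistable pairs from the registered fact (§3).
[cite: Castella2018, Thm. 3.2 (arXiv:1704.06608 p. 9) (shape only; nothing asserted)] -/
def R1.BDPValueAllFramesOnTree : Prop :=
  ∀ [NeZero (W.conductorNorm ℤ)] (q : ℕ) [Fact q.Prime] (K : Type) [Field K] [NumberField K]
    (Dt : ModularParametrizationData W (W.conductorNorm ℤ))
    (H : HeegnerDatum (W.conductorNorm ℤ) (NumberField.discr K)) (ιK : K →+* ℂ)
    (P : (W.baseChange K).toAffine.Point) (hE : ErratumHypotheses W p), W.analyticRank = 1 →
    ∀ (hqp : q ≠ p), Mult W q → ¬ W.HasSplitMultiplicativeReductionAtPrime q →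
    ¬ p ∣ padicValInt q W.minimalDiscriminantInt → ∀ (hK : IsErratumField W K q),
    Cas20Standing K p (W.conductorNorm ℤ / p) →
    WeierstrassCurve.Affine.Point.map ιK.toRatAlgHom P = heegnerPointComplex Dt H →
    ¬ (p : ℤ) ∣ Dt.c → ¬ IsOfFinAddOrder P →
    ∀ (f : CuspForm (CongruenceSubgroup.Gamma0 (W.conductorNorm ℤ)) 2), IsNewformOf W f →
    ∀ (κ : ZpExtension K p), κ.IsAnticyclotomic →
      ∀ (γ : Field.absoluteGaloisGroup K) [Fact (κ.IsTopGenerator γ)] (ι' : PadicAlgCl p ≃+* ℂ)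
        (w₀ : InfinitePlace K) (ΩK : ℂ) (Ωp : (unrIntegers p)ˣ) (L : UnrSeries p), ΩK ≠ 0 →
        IsBDPLFunction ι' (primeOfEmbeddingDatum p ι' w₀.embedding) κ γ f ΩK
          ((Ωp : unrIntegers p) : ℂ_[p]) L →
        R1.BDPValueAtOneOnTreeAt W p
          (embAt K p (primeOfEmbeddingDatum p ι' w₀.embedding)
            (natCast_mem_primeOfEmbeddingDatum p ι' w₀.embedding)
            (degreeOne_primeOfEmbeddingDatum_of_isErratumField hK
              (dvd_conductorNorm_of_mult hE.2.1) hqp ι' w₀.embedding).1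
            (degreeOne_primeOfEmbeddingDatum_of_isErratumField hK
              (dvd_conductorNorm_of_mult hE.2.1) hqp ι' w₀.embedding).2)
          P L (W.LFunction p)

/-- **H3∀′ — erratum Thm. 1.1's main-conjecture EQUALITY at EVERY GENUINE frame of route R1's data
(OPEN shape, typed; the gen-21 body of `R1.IMCEqOnTree` verbatim plus the binder `Ω_K ≠ 0`).** For
the same data, newform `f`, `(κ, γ)`, `ι'`, `w₀` and every frame `(Ω_K ≠ 0, Ω_p ∈ R₀ˣ, L)` with
`IsBDPLFunction ι' 𝔭_{ι'} κ γ f Ω_K Ω_p L`: `Ch_Λ(X_ac^∅(E[p^∞]))·R₀⟦T⟧ = (L)` at `𝔭_{ι'}`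
(`R1.IMCEqOnTreeAt`). On semistable pairs, given A206, EQUIVALENT to the ∃-core shape of record
`R1.IMCEqCoreFrameOnTree` (§4). A predicate on `(W, p)`; NEVER a theorem in this cell; every result
using it is CONDITIONAL. [claim: Castella2018Erratum, status: under-review] -/
def R1.IMCEqAllFramesOnTree : Prop :=
  ∀ [NeZero (W.conductorNorm ℤ)] (q : ℕ) [Fact q.Prime] (K : Type) [Field K] [NumberField K]
    (Dt : ModularParametrizationData W (W.conductorNorm ℤ))
    (H : HeegnerDatum (W.conductorNorm ℤ) (NumberField.discr K)) (ιK : K →+* ℂ)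
    (P : (W.baseChange K).toAffine.Point), ErratumHypotheses W p → W.analyticRank = 1 →
    q ≠ p → Mult W q → ¬ W.HasSplitMultiplicativeReductionAtPrime q →
    ¬ p ∣ padicValInt q W.minimalDiscriminantInt → IsErratumField W K q →
    Cas20Standing K p (W.conductorNorm ℤ / p) →
    WeierstrassCurve.Affine.Point.map ιK.toRatAlgHom P = heegnerPointComplex Dt H →
    ¬ (p : ℤ) ∣ Dt.c → ¬ IsOfFinAddOrder P →
    ∀ (f : CuspForm (CongruenceSubgroup.Gamma0 (W.conductorNorm ℤ)) 2), IsNewformOf W f →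
    ∀ (κ : ZpExtension K p), κ.IsAnticyclotomic →
      ∀ (γ : Field.absoluteGaloisGroup K) [Fact (κ.IsTopGenerator γ)] (ι' : PadicAlgCl p ≃+* ℂ)
        (w₀ : InfinitePlace K) (ΩK : ℂ) (Ωp : (unrIntegers p)ˣ) (L : UnrSeries p), ΩK ≠ 0 →
        IsBDPLFunction ι' (primeOfEmbeddingDatum p ι' w₀.embedding) κ γ f ΩK
          ((Ωp : unrIntegers p) : ℂ_[p]) L →
        R1.IMCEqOnTreeAt W p κ (primeOfEmbeddingDatum p ι' w₀.embedding) γ L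

end Shapes

/-! ### §2 The gen-21 shapes imply the corrected ones (nothing typed before is lost) -/

section FromGen21

variable {W : WeierstrassCurve ℚ} [W.IsElliptic] [W.IsGloballyMinimal] {p : ℕ} [Fact p.Prime]

/-- Gen 21's H2∀ implies H2∀′ (forget the binder). The converse fails: H2∀ is refutable on the
population (`R1.not_bdpValueOnTree_of_facts`) while H2∀′ is a theorem on semistable pairs (§3).
[cite: Castella2018, Thm. 3.2 (arXiv:1704.06608 p. 9) (shape only)] -/
theorem R1.bdpValueAllFramesOnTree_of_bdpValueOnTree (h2 : R1.BDPValueOnTree W p) :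
    R1.BDPValueAllFramesOnTree W p := by
  intro _ q _ K _ _ Dt H ιK P hE hr hqp hmq hns hvq hK hCas hP hc hinf f hfW κ hκ γ _ ι' w₀ ΩK Ωp L
    _ hL
  exact h2 q K Dt H ιK P hE hr hqp hmq hns hvq hK hCas hP hc hinf f hfW κ hκ γ ι' w₀ ΩK Ωp L hL

omit [W.IsElliptic] in
/-- Gen 21's H3∀ implies H3∀′ (forget the binder). The converse fails: H3∀ is refutable on the
population (`R1.not_imcEqOnTree_of_facts`). [cite: Castella2018Erratum, Thm. 1.1 (p. 1)] -/
theorem R1.imcEqAllFramesOnTree_of_imcEqOnTree (h3 : R1.IMCEqOnTree W p) :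
    R1.IMCEqAllFramesOnTree W p := by
  intro _ q _ K _ _ Dt H ιK P hE hr hqp hmq hns hvq hK hCas hP hc hinf f hfW κ hκ γ _ ι' w₀ ΩK Ωp L
    _ hL
  exact h3 q K Dt H ιK P hE hr hqp hmq hns hvq hK hCas hP hc hinf f hfW κ hκ γ ι' w₀ ΩK Ωp L hL

end FromGen21

/-! ### §3 H2∀′ is a THEOREM on semistable pairs, from the published value formula -/

section ValueFromPrint

variable {W : WeierstrassCurve ℚ} [W.IsElliptic] [W.IsGloballyMinimal] {p : ℕ} [Fact p.Prime]

omit [W.IsElliptic] [W.IsGloballyMinimal] in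
/-- The Galois re-reading of a datum: for an erratum field `K` (imaginary quadratic), a complex
embedding `ι_K` and an infinite place `w₀`, there is an involution `τ` of `K` with
`w₀.embedding ∘ τ = ι_K`; so `τ_* P` reads through `w₀.embedding` whatever `P` reads through `ι_K`,
and `τ_* P` has infinite order with `P`. [folklore] -/
theorem R1.exists_involution_map_eq {K : Type} [Field K] [NumberField K] {q : ℕ}
    (hK : IsErratumField W K q) (ιK : K →+* ℂ) (w₀ : InfinitePlace K) {N : ℕ} [NeZero N]
    (Dt : ModularParametrizationData W N) (H : HeegnerDatum N (NumberField.discr K))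
    {P : (W.baseChange K).toAffine.Point}
    (hP : WeierstrassCurve.Affine.Point.map ιK.toRatAlgHom P = heegnerPointComplex Dt H)
    (hinf : ¬ IsOfFinAddOrder P) :
    ∃ τ : K →+* K, (∀ x, τ (τ x) = x) ∧
      WeierstrassCurve.Affine.Point.map w₀.embedding.toRatAlgHom
          (WeierstrassCurve.Affine.Point.map τ.toRatAlgHom P) = heegnerPointComplex Dt H ∧
      ¬ IsOfFinAddOrder (WeierstrassCurve.Affine.Point.map τ.toRatAlgHom P) := by
  haveI : IsGalois ℚ K := by
    haveI : Algebra.IsQuadraticExtension ℚ K := ⟨hK.1.1⟩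
    infer_instance
  obtain ⟨σ, hσ⟩ := ComplexEmbedding.exists_comp_symm_eq_of_comp_eq (k := ℚ) w₀.embedding ιK
    (by ext x; simp)
  set τ : K →+* K := ((σ.symm : K ≃ₐ[ℚ] K) : K →+* K) with hτdef
  have hτ : ∀ x, τ (τ x) = x := by
    intro x
    have hcard : Nat.card (K ≃ₐ[ℚ] K) = 2 := by rw [IsGalois.card_aut_eq_finrank, hK.1.1]
    have hsq : σ.symm * σ.symm = 1 := by
      have h := pow_card_eq_one' (G := K ≃ₐ[ℚ] K) (x := σ.symm)
      rwa [hcard, pow_two] at h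
    have := congrArg (fun g : K ≃ₐ[ℚ] K ↦ g x) hsq
    simpa [hτdef, AlgEquiv.mul_apply] using this
  refine ⟨τ, hτ, ?_, fun h ↦ hinf
    ((WeierstrassCurve.Affine.Point.map_injective (f := τ.toRatAlgHom)).isOfFinAddOrder_iff.mp h)⟩
  rw [WeierstrassCurve.Affine.Point.map_map]
  have hcomp : w₀.embedding.toRatAlgHom.comp τ.toRatAlgHom = ιK.toRatAlgHom := by
    apply AlgHom.ext
    intro x
    have := RingHom.congr_fun hσ x
    simpa [hτdef] using this
  rw [hcomp]
  exact hP

/-- **H2∀′ on a SEMISTABLE pair is a THEOREM from print.** Given the registered published fact `h32`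
(Cas18 Thms. 3.1–3.2: at each datum read through `w₀.embedding` a frame `(Ω_K' ≠ 0, Ω_p', L')` with
the interpolation property AND the value at `𝟙`), `hGZK` and `hmod` (`rank_ℤ E(K) = 1` on the erratum
field): for EVERY frame `(Ω_K ≠ 0, Ω_p ∈ R₀ˣ, L)` of a datum, `L(𝟙) = u·((1 − a_p(E) p⁻¹)·log_{ω_E} P)²`.
Per datum: `f = f_{Dt}` (multiplicity one, `IsNewformOf.unique`); the datum's `ι_K` is
`w₀.embedding ∘ τ` for an involution `τ` (`R1.exists_involution_map_eq`), so `h32` applies at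
`τ_* P` with the embedding `embAt K p 𝔭_{ι'}` (which induces `𝔭_{ι'}`); VALUE RIGIDITY ACROSS
PERIODS (`R1.bdpValueAtOneOnTreeAt_of_isBDPLFunction`: `p ≥ 5` odd, `K` imaginary quadratic, `κ`
anticyclotomic, all periods non-zero — HERE the binder `Ω_K ≠ 0` is used) moves the value shape
from `L'` to `L`; `(log_{ω_E} τ_* P)² = (log_{ω_E} P)²` (`R1.bdpValueAtOneOnTreeAt_map_iff_of_rank_one`)
moves it from `τ_* P` to `P`. CONDITIONAL on the published facts only.
[cite: Castella2018, Thm. 3.1, display (3.2) and Thm. 3.2 (arXiv:1704.06608 p. 9)] -/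
theorem R1.bdpValueAllFramesOnTree_of_thm32 (h32 : thm32_exists_isBDPLFunction_valueAtOne)
    (hGZK : rank_eq_analyticRank_of_analyticRank_le_one) (hmod : exists_isNewformOf)
    (hss : Semistable W) : R1.BDPValueAllFramesOnTree W p := by
  intro _ q _ K _ _ Dt H ιK P hE hr hqp hmq hns hvq hK hCas hP hc hinf f hfW κ hκ γ _ ι' w₀ ΩK Ωp L
    hΩ hL
  obtain rfl : f = Dt.f := hfW.unique Dt.isNewformOf
  have hp2 : p ≠ 2 := hE.two_ne
  have hrk : (W.baseChange K).mordellWeilRank = 1 :=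
    (IsErratumField.mordellWeilRank_eq_one_and_shaFinite W hGZK hmod hr hK).1
  obtain ⟨τ, hτ, hP', hinf'⟩ := R1.exists_involution_map_eq hK ιK w₀ Dt H hP hinf
  -- THE embedding at `𝔭_{ι'}` induces `𝔭_{ι'}`
  have hemb := mem_asIdeal_iff_norm_embAt_lt_one (primeOfEmbeddingDatum p ι' w₀.embedding)
    (natCast_mem_primeOfEmbeddingDatum p ι' w₀.embedding)
    (degreeOne_primeOfEmbeddingDatum_of_isErratumField hK (dvd_conductorNorm_of_mult hE.2.1) hqp ι'
      w₀.embedding).1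
    (degreeOne_primeOfEmbeddingDatum_of_isErratumField hK (dvd_conductorNorm_of_mult hE.2.1) hqp ι'
      w₀.embedding).2
  -- the published frame at `τ_* P`, with its value at `𝟙`
  obtain ⟨ΩK', Ωp', L', hΩ', hL', h2'⟩ :=
    R1.exists_frame_bdpValueAtOneOnTreeAt_of_thm32 h32 ι' Dt H hE hss hqp hK hc w₀ hP' κ hκ γ hemb
  have hΩp : ((Ωp : unrIntegers p) : ℂ_[p]) ≠ 0 := by
    rw [Ne, ZeroMemClass.coe_eq_zero]
    exact Units.ne_zero Ωp
  have hΩp' : ((Ωp' : unrIntegers p) : ℂ_[p]) ≠ 0 := by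
    rw [Ne, ZeroMemClass.coe_eq_zero]
    exact Units.ne_zero Ωp'
  -- value rigidity across periods: the value shape at `τ_* P` holds for `L` too; then back to `P`
  exact (R1.bdpValueAtOneOnTreeAt_map_iff_of_rank_one W p _ τ hτ hrk hinf L _).mp
    (R1.bdpValueAtOneOnTreeAt_of_isBDPLFunction hp2 hK.1 hκ hΩ hΩ' hΩp hΩp' hL hL' h2')

end ValueFromPrint

/-! ### §4 H3∀′ ⟺ H3∃⁻: the main-conjecture half is one frame-independent statement per datum -/

section Rigidity

variable {W : WeierstrassCurve ℚ} [W.IsElliptic] [W.IsGloballyMinimal] {p : ℕ} [Fact p.Prime]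

/-- **H3∃⁻ ⟹ H3∀′ — NO fact, NO semistability.** If at every datum (read through an infinite place)
SOME frame `(Ω_K₀ ≠ 0, Ω_p₀ ∈ R₀ˣ, L₀)` of `f_{Dt}` satisfies the main-conjecture equality
(`R1.IMCEqCoreFrameOnTree`, gen 25), then EVERY frame `(Ω_K ≠ 0, Ω_p ∈ R₀ˣ, L)` of every datum (read
through any `ι_K`) and every newform `f` of `E` does: `f = f_{Dt}` (multiplicity one,
`IsNewformOf.unique`); re-read the datum through `w₀` at `τ_* P` (`R1.exists_involution_map_eq`; the
conclusion `Ch_Λ(X_ac^∅)·R₀⟦T⟧ = (L)` does not involve `P`); `embAt K p 𝔭_{ι'}` induces `𝔭_{ι'}`; and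
IDEAL RIGIDITY ACROSS PERIODS (`R1.imcEqOnTreeAt_forall_of_exists`, gen 25: `p ≥ 5` odd, `K`
imaginary quadratic, `κ` anticyclotomic, periods non-zero) transports the equality from `L₀` to `L`.
CONDITIONAL on H3∃⁻ (open). [cite: Castella2018Erratum, Thm. 1.1 (p. 1)]
[cite: Castella2018, Thm. 3.1 (arXiv:1704.06608 p. 9)] -/
theorem R1.imcEqAllFramesOnTree_of_imcEqCoreFrame (h3 : R1.IMCEqCoreFrameOnTree W p) :
    R1.IMCEqAllFramesOnTree W p := by
  intro _ q _ K _ _ Dt H ιK P hE hr hqp hmq hns hvq hK hCas hP hc hinf f hfW κ hκ γ _ ι' w₀ ΩK Ωp L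
    hΩ hL
  obtain rfl : f = Dt.f := hfW.unique Dt.isNewformOf
  have hp2 : p ≠ 2 := hE.two_ne
  obtain ⟨τ, hτ, hP', hinf'⟩ := R1.exists_involution_map_eq hK ιK w₀ Dt H hP hinf
  have hemb := mem_asIdeal_iff_norm_embAt_lt_one (primeOfEmbeddingDatum p ι' w₀.embedding)
    (natCast_mem_primeOfEmbeddingDatum p ι' w₀.embedding)
    (degreeOne_primeOfEmbeddingDatum_of_isErratumField hK (dvd_conductorNorm_of_mult hE.2.1) hqp ι'
      w₀.embedding).1
    (degreeOne_primeOfEmbeddingDatum_of_isErratumField hK (dvd_conductorNorm_of_mult hE.2.1) hqp ι'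
      w₀.embedding).2
  obtain ⟨ΩK₀, Ωp₀, L₀, hΩ₀, hL₀, h3₀⟩ :=
    h3 q K Dt H w₀ _ hE hr hqp hmq hns hvq hK hCas hP' hc hinf' κ hκ γ ι' _ hemb
  have hΩp : ((Ωp : unrIntegers p) : ℂ_[p]) ≠ 0 := by
    rw [Ne, ZeroMemClass.coe_eq_zero]
    exact Units.ne_zero Ωp
  have hΩp₀ : ((Ωp₀ : unrIntegers p) : ℂ_[p]) ≠ 0 := by
    rw [Ne, ZeroMemClass.coe_eq_zero]
    exact Units.ne_zero Ωp₀
  exact R1.imcEqOnTreeAt_forall_of_exists hp2 hK.1 hκ ⟨ΩK₀, _, L₀, hΩ₀, hΩp₀, hL₀, h3₀⟩ hΩ hΩp hL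

/-- **H3∀′ ⟹ H3∃⁻ on a SEMISTABLE pair, given EXISTENCE of a frame (A206).** At a datum read through
`w₀`, Castella 2018 Thm. 3.1 (`hBDP` = A206, `exists_isBDPLFunction_of_erratumHypotheses`) supplies
a frame `(Ω_K ≠ 0, Ω_p ∈ R₀ˣ, L)` of `f_{Dt}` at `𝔭_{ι'}`; H3∀′ at the datum (`ι_K := w₀.embedding`)
gives the main-conjecture equality there. CONDITIONAL on A206 (published) and H3∀′ (open).
[cite: Castella2018, Thm. 3.1 (arXiv:1704.06608 p. 9)] [cite: Castella2018Erratum, Thm. 1.1 (p. 1)] -/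
theorem R1.imcEqCoreFrameOnTree_of_imcEqAllFrames_of_bdpExists
    (hBDP : castella2018_exists_isBDPLFunction) (hss : Semistable W)
    (h3 : R1.IMCEqAllFramesOnTree W p) : R1.IMCEqCoreFrameOnTree W p := by
  intro _ q _ K _ _ Dt H w₀ P hE hr hqp hmq hns hvq hK hCas hP hc hinf κ hκ γ _ ι' e _
  obtain ⟨ΩK, Ωp, L, hΩ, hL⟩ :=
    exists_isBDPLFunction_of_erratumHypotheses hBDP ι' Dt.isNewformOf hE hss hqp hK κ hκ γ w₀
  exact ⟨ΩK, Ωp, L, hΩ, hL, h3 q K Dt H w₀.embedding P hE hr hqp hmq hns hvq hK hCas hP hc hinf Dt.f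
    Dt.isNewformOf κ hκ γ ι' w₀ ΩK Ωp L hΩ hL⟩

/-- **H3∀′ ⟹ H3∃⁻ on a SEMISTABLE pair, given `h32`** (Cas18 Thms. 3.1–3.2 in the registry's
∃∧-currency, which contains the existence of a frame with `Ω_K ≠ 0`:
`R1.exists_frame_bdpValueAtOneOnTreeAt_of_thm32`). CONDITIONAL on `h32` (published) and H3∀′ (open).
[cite: Castella2018, Thm. 3.1 and Thm. 3.2 (arXiv:1704.06608 p. 9)] [cite: Castella2018Erratum, Thm. 1.1 (p. 1)] -/
theorem R1.imcEqCoreFrameOnTree_of_imcEqAllFrames_of_thm32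
    (h32 : thm32_exists_isBDPLFunction_valueAtOne) (hss : Semistable W)
    (h3 : R1.IMCEqAllFramesOnTree W p) : R1.IMCEqCoreFrameOnTree W p := by
  intro _ q _ K _ _ Dt H w₀ P hE hr hqp hmq hns hvq hK hCas hP hc hinf κ hκ γ _ ι' e he
  obtain ⟨ΩK, Ωp, L, hΩ, hL, -⟩ :=
    R1.exists_frame_bdpValueAtOneOnTreeAt_of_thm32 h32 ι' Dt H hE hss hqp hK hc w₀ hP κ hκ γ he
  exact ⟨ΩK, Ωp, L, hΩ, hL, h3 q K Dt H w₀.embedding P hE hr hqp hmq hns hvq hK hCas hP hc hinf Dt.f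
    Dt.isNewformOf κ hκ γ ι' w₀ ΩK Ωp L hΩ hL⟩

/-- **H3∀′ ⟺ H3∃⁻ on SEMISTABLE pairs, given A206**: the corrected ∀-frame half and the ∃-core shape
of record are EQUIVALENT — route R1's main-conjecture half is ONE frame-independent statement per
datum. (For the uncorrected gen-21 shape the `⟸` direction is FALSE: `R1.not_imcEqOnTree_of_facts`.)
CONDITIONAL on A206 (published). [cite: Castella2018, Thm. 3.1 (arXiv:1704.06608 p. 9)]
[cite: Castella2018Erratum, Thm. 1.1 (p. 1)] -/
theorem R1.imcEqAllFramesOnTree_iff_imcEqCoreFrame (hBDP : castella2018_exists_isBDPLFunction)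
    (hss : Semistable W) : R1.IMCEqAllFramesOnTree W p ↔ R1.IMCEqCoreFrameOnTree W p :=
  ⟨R1.imcEqCoreFrameOnTree_of_imcEqAllFrames_of_bdpExists hBDP hss,
    R1.imcEqAllFramesOnTree_of_imcEqCoreFrame⟩

/-- **… and with gen 22's full frame form H3∃** (`R1.IMCEqFrameOnTree`: interpolation ∧ value ∧
equality for ONE frame) on SEMISTABLE pairs, given `h32`: H3∀′ ⟺ H3∃ (value conjunct from print,
`R1.imcEqFrameOnTree_of_thm32_of_imcEqCoreFrame`). CONDITIONAL on `h32` (published).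
[cite: Castella2018, Thm. 3.1 and Thm. 3.2 (arXiv:1704.06608 p. 9)] [cite: Castella2018Erratum, Thm. 1.1 (p. 1)] -/
theorem R1.imcEqAllFramesOnTree_iff_imcEqFrame (h32 : thm32_exists_isBDPLFunction_valueAtOne)
    (hss : Semistable W) : R1.IMCEqAllFramesOnTree W p ↔ R1.IMCEqFrameOnTree W p :=
  ⟨fun h3 ↦ R1.imcEqFrameOnTree_of_thm32_of_imcEqCoreFrame h32 hss
      (R1.imcEqCoreFrameOnTree_of_imcEqAllFrames_of_thm32 h32 hss h3),
    fun h3 ↦ R1.imcEqAllFramesOnTree_of_imcEqCoreFrame (R1.imcEqCoreFrameOnTree_of_imcEqFrame h3)⟩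

end Rigidity

end Summit.BirchSwinnertonDyer.Rank1Residual.X11b

end
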